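import Summits.CriticalPhenomena.PercolationContinuityZ3.Theorems.PercNearOneGluingNoHeavyQuantThetaSmoothAtOne
import Summits.CriticalPhenomena.PercolationContinuityZ3.Theorems.PercNearOneGluingNoHeavyQuantThetaGermAtOneBoundary
import HarnessLib

/-!
# The Taylor germ of `θ` at `p = 1`, part II: `θ^{(k)}(1⁻) = 0` for `1 ≤ k < 2d` and `θ^{(2d)}(1⁻) = −(2d)!`,
# every `d ≥ 2` (quant lane, METHOD = differential inequalities for `θ`, seat p4 gen 15)

builds on p205010 (kernel theorem, internal audit signed; external expert review pending) — NOT used in this file.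

The first application of the one-sided smoothness at `p = 1` (`…QuantThetaSmoothAtOne`, Grimmett Thm. (8.92) at
`p = 1`): the left Taylor coefficients of `θ` at `1` are those of `1 − (1−p)^{2d}` up to order `2d`,
i.e. `θ(p) = 1 − (1−p)^{2d} + O((1−p)^{2d+1})` (`p ↑ 1`) at the level of one-sided derivatives — the leading term of the
high-density ('perimeter polynomial') expansion `1 − θ(p) = Σ_n P_p(|C| = n) = q^{2d} + 2d·p·q^{4d−2} + …`, `q = 1 − p`.

* §1 Calculus: `((1−q)^b)^{(j)} = (−1)^j b^{(j)} (1−q)^{b−j}` (falling factorial), so `(f·(1−q)^b)^{(k)}(1) = 0` for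
  `k < b` and `(q^a(1−q)^b)^{(b)}(1) = (−1)^b b!`.
* §2 The polynomial `H_n = Russo.cylPoly E K_n {|C| = n}` is `Σ_{S ⊆ K_n admissible} q^{#S}(1−q)^{#(K_n∖S)}`; with part I
  (`ThetaGerm.card_sdiff_ge`: `#(K_n∖S) ≥ 2d+1` for `n ≥ 2`; the `2d` origin edges for `n = 1`):
  **`H_n^{(k)}(1) = 0` for `k < 2d`** (all `n`) and **`H_n^{(2d)}(1) = (2d)!·𝟙{n = 1}`**.
* §3 Termwise at `p = 1` through the closed-window engine (`ChiF.hasDerivWithinAt_tsum_window`):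
  **`ThetaGerm.iteratedDerivWithin_theta_one_eq_zero`** (`1 ≤ k < 2d`), **`ThetaGerm.iteratedDerivWithin_theta_one_two_mul`**
  (`= −(2d)!`), window-free forms within `(-∞, 1]`, and **`ThetaGerm.hasDerivWithinAt_theta_one`**: `θ'(1⁻) = 0`.

HONEST STATUS: elementary consequence (ours) of the reproduced Thm. (8.92) at `p = 1`; classical as a series statement
(Sykes–Essam perimeter polynomials); no rate, nothing at `p_c`.

## References
* G. Grimmett, *Percolation*, 2nd ed. (1999): §8.7 Thm. (8.92), (8.93)–(8.96) [GrimmettPercolation1999].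
-/

noncomputable section

namespace Summit.CriticalPhenomena.PercolationContinuityZ3.Theorems

open MeasureTheory Set Filter Topology Literature.Probability.Percolation Literature.Probability.LatticeModels
open scoped Classical

namespace ThetaGerm

variable {d : ℕ}

/-! ### §1. Calculus of `f(q)·(1−q)^b` at `q = 1` -/

/-- `((1−q)^b)^{(j)}(x) = (−1)^j · b(b−1)⋯(b−j+1) · (1−x)^{b−j}`. -/
theorem iteratedDeriv_one_sub_pow (b j : ℕ) (x : ℝ) :
    iteratedDeriv j (fun q : ℝ => (1 - q) ^ b) x = (-1) ^ j * (b.descFactorial j : ℝ) * (1 - x) ^ (b - j) := by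
  induction j generalizing x with
  | zero => simp
  | succ j ih =>
    rw [iteratedDeriv_succ]
    have hfun : iteratedDeriv j (fun q : ℝ => (1 - q) ^ b) = fun x => (-1) ^ j * (b.descFactorial j : ℝ) * (1 - x) ^ (b - j) :=
      funext ih
    rw [hfun]
    have hd : HasDerivAt (fun x : ℝ => (-1) ^ j * (b.descFactorial j : ℝ) * (1 - x) ^ (b - j))
        ((-1) ^ j * (b.descFactorial j : ℝ) * (((b - j : ℕ) : ℝ) * (1 - x) ^ (b - j - 1) * (-1))) x :=
      (((hasDerivAt_id x).const_sub 1).pow (b - j)).const_mul _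
    rw [hd.deriv, Nat.descFactorial_succ, Nat.cast_mul, show b - j - 1 = b - (j + 1) by omega]
    ring

/-- `(f·(1−q)^b)^{(k)}(1) = 0` for `k < b` (`f` smooth). -/
theorem iteratedDeriv_mul_one_sub_pow_eq_zero {f : ℝ → ℝ} (hf : ContDiff ℝ (⊤ : ℕ∞) f) {k b : ℕ} (hkb : k < b) :
    iteratedDeriv k (fun q : ℝ => f q * (1 - q) ^ b) 1 = 0 := by
  have hg : ContDiff ℝ (⊤ : ℕ∞) (fun q : ℝ => (1 - q) ^ b) := (contDiff_const.sub contDiff_id).pow b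
  rw [iteratedDeriv_fun_mul (hf.contDiffAt.of_le (mod_cast le_top)) (hg.contDiffAt.of_le (mod_cast le_top))]
  refine Finset.sum_eq_zero fun i hi => ?_
  rw [iteratedDeriv_one_sub_pow]
  have : b - (k - i) ≠ 0 := by have := Finset.mem_range.1 hi; omega
  simp [zero_pow this]

/-- `(q^a(1−q)^b)^{(b)}(1) = (−1)^b · b!`. -/
theorem iteratedDeriv_pow_mul_one_sub_pow_self (a b : ℕ) :
    iteratedDeriv b (fun q : ℝ => q ^ a * (1 - q) ^ b) 1 = (-1) ^ b * (b.factorial : ℝ) := by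
  have hf : ContDiff ℝ (⊤ : ℕ∞) (fun q : ℝ => q ^ a) := contDiff_id.pow a
  have hg : ContDiff ℝ (⊤ : ℕ∞) (fun q : ℝ => (1 - q) ^ b) := (contDiff_const.sub contDiff_id).pow b
  rw [iteratedDeriv_fun_mul (hf.contDiffAt.of_le (mod_cast le_top)) (hg.contDiffAt.of_le (mod_cast le_top)),
    Finset.sum_range_succ', Finset.sum_eq_zero]
  · simp [iteratedDeriv_one_sub_pow, Nat.descFactorial_self]
  · intro i hi
    rw [iteratedDeriv_one_sub_pow]
    have : b - (b - (i + 1)) ≠ 0 := by have := Finset.mem_range.1 hi; omega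
    simp [zero_pow this]

/-! ### §2. The polynomials `H_n` at `q = 1` -/

/-- On lattice edges, the weight product of a cylinder is `q^{#S}(1−q)^{#(K∖S)}`. -/
theorem prod_weight_eq {K S : Finset (Sym2 (Site d))} (hK : ∀ e ∈ K, e ∈ (zdGraph d).edgeSet) (hS : S ⊆ K) (q : ℝ) :
    ∏ i ∈ K, Russo.weight (zdGraph d).edgeSet (↑S : Set (Sym2 (Site d))) i q = q ^ S.card * (1 - q) ^ (K \ S).card := by
  rw [← Finset.prod_sdiff hS]
  rw [Finset.prod_congr rfl fun i hi => show Russo.weight (zdGraph d).edgeSet (↑S : Set (Sym2 (Site d))) i q = 1 - q by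
      obtain ⟨hiK, hiS⟩ := Finset.mem_sdiff.1 hi
      simp only [Russo.weight, Finset.mem_coe, hiS, hK i hiK, if_false, if_true],
    Finset.prod_congr rfl fun i hi => show Russo.weight (zdGraph d).edgeSet (↑S : Set (Sym2 (Site d))) i q = q by
      simp only [Russo.weight, Finset.mem_coe, hi, hK i (hS hi), if_true],
    Finset.prod_const, Finset.prod_const, mul_comm]

/-- **`cylPoly` as a sum of monomials `q^{#S}(1−q)^{#(K∖S)}` over the admissible `S ⊆ K`**, and its iterated derivatives
termwise. -/
theorem iteratedDeriv_cylPoly_eq_sum {K : Finset (Sym2 (Site d))} (hK : ∀ e ∈ K, e ∈ (zdGraph d).edgeSet)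
    (B : Set (BondConfig (Site d))) [DecidablePred fun S : Finset (Sym2 (Site d)) => (↑S : Set (Sym2 (Site d))) ∈ B]
    (k : ℕ) (x : ℝ) :
    iteratedDeriv k (Russo.cylPoly (zdGraph d).edgeSet K B) x =
      ∑ S ∈ K.powerset.filter (fun S : Finset (Sym2 (Site d)) => (↑S : Set (Sym2 (Site d))) ∈ B),
        iteratedDeriv k (fun q : ℝ => q ^ S.card * (1 - q) ^ (K \ S).card) x := by
  have hfun : Russo.cylPoly (zdGraph d).edgeSet K B = fun q =>
      ∑ S ∈ K.powerset.filter (fun S : Finset (Sym2 (Site d)) => (↑S : Set (Sym2 (Site d))) ∈ B),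
        q ^ S.card * (1 - q) ^ (K \ S).card := by
    funext q
    simp only [Russo.cylPoly]
    rw [Finset.sum_filter]
    refine Finset.sum_congr rfl fun S hS => ?_
    split_ifs with h
    · exact prod_weight_eq hK (Finset.mem_powerset.1 hS) q
    · rfl
  have hsmooth : ∀ S ∈ K.powerset.filter (fun S : Finset (Sym2 (Site d)) => (↑S : Set (Sym2 (Site d))) ∈ B),
      ContDiffAt ℝ k (fun q : ℝ => q ^ S.card * (1 - q) ^ (K \ S).card) x := fun S _ =>
    (by fun_prop : ContDiff ℝ k (fun q : ℝ => q ^ S.card * (1 - q) ^ (K \ S).card)).contDiffAt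
  rw [hfun, iteratedDeriv_eq_iteratedFDeriv, iteratedFDeriv_fun_sum_apply hsmooth, _root_.sum_apply]
  refine Finset.sum_congr rfl fun S _ => ?_
  rw [iteratedDeriv_eq_iteratedFDeriv]

/-- **`H_n^{(k)}(1) = 0` for `k < 2d`**, every `n` (`d ≥ 2`): every admissible `S` leaves at least `2d` edges of `K_n`
closed. -/
theorem iteratedDeriv_cylPoly_one_eq_zero (hd : 2 ≤ d) (n : ℕ) {k : ℕ} (hk : k < 2 * d) :
    iteratedDeriv k (Russo.cylPoly (zdGraph d).edgeSet (edgesTouching (zdGraph d) (box d n))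
      {ω : BondConfig (Site d) | ω ∩ (zdGraph d).edgeSet ∈
        {ω' : BondConfig (Site d) | (openCluster ω' 0).Finite ∧ (openCluster ω' 0).ncard = n}}) 1 = 0 := by
  rw [iteratedDeriv_cylPoly_eq_sum (ChiF.edgesTouching_box_subset n)]
  refine Finset.sum_eq_zero fun S hS => ?_
  obtain ⟨hSK, hadm⟩ := Finset.mem_filter.1 hS
  rw [Finset.mem_powerset] at hSK
  simp only [Set.mem_setOf_eq] at hadm
  refine iteratedDeriv_mul_one_sub_pow_eq_zero (contDiff_id.pow _) (lt_of_lt_of_le hk ?_)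
  rcases Nat.lt_or_ge n 2 with hn | hn
  · interval_cases n
    · exact absurd hadm (not_ncard_eq_zero _)
    · calc 2 * d = (((zdGraph d).neighborFinset 0).image fun u : Site d => s((0 : Site d), u)).card := (card_originEdges d).symm
        _ ≤ _ := Finset.card_le_card (originEdges_subset_sdiff ((ncard_eq_one_iff S).1 hadm) 1)
  · exact le_trans (Nat.le_succ _) (card_sdiff_ge hd hn hadm.1 hadm.2)

/-- **`H_n^{(2d)}(1) = (2d)!·𝟙{n = 1}`** (`d ≥ 2`): for `n ≥ 2` at least `2d + 1` edges are closed; for `n = 1` the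
only admissible `S` with exactly `2d` closed edges is `K_1 ∖ {origin edges}`. -/
theorem iteratedDeriv_cylPoly_one_two_mul (hd : 2 ≤ d) (n : ℕ) :
    iteratedDeriv (2 * d) (Russo.cylPoly (zdGraph d).edgeSet (edgesTouching (zdGraph d) (box d n))
      {ω : BondConfig (Site d) | ω ∩ (zdGraph d).edgeSet ∈
        {ω' : BondConfig (Site d) | (openCluster ω' 0).Finite ∧ (openCluster ω' 0).ncard = n}}) 1 =
      if n = 1 then ((2 * d).factorial : ℝ) else 0 := by
  rw [iteratedDeriv_cylPoly_eq_sum (ChiF.edgesTouching_box_subset n)]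
  split_ifs with h1
  · subst h1
    set K : Finset (Sym2 (Site d)) := edgesTouching (zdGraph d) (box d 1) with hK
    have hOK : (((zdGraph d).neighborFinset 0).image fun u : Site d => s((0 : Site d), u)) ⊆ K := originEdges_subset 1
    have hmem : K \ (((zdGraph d).neighborFinset 0).image fun u : Site d => s((0 : Site d), u)) ∈ K.powerset.filter (fun S : Finset (Sym2 (Site d)) => (↑S : Set (Sym2 (Site d))) ∈
        {ω : BondConfig (Site d) | ω ∩ (zdGraph d).edgeSet ∈
          {ω' : BondConfig (Site d) | (openCluster ω' 0).Finite ∧ (openCluster ω' 0).ncard = 1}}) := by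
      refine Finset.mem_filter.2 ⟨Finset.mem_powerset.2 Finset.sdiff_subset, ?_⟩
      simp only [Set.mem_setOf_eq]
      exact (ncard_eq_one_iff _).2 fun e he hmem => (Finset.mem_sdiff.1 hmem).2 he
    rw [Finset.sum_eq_single_of_mem _ hmem]
    · rw [Finset.sdiff_sdiff_eq_self hOK, card_originEdges, iteratedDeriv_pow_mul_one_sub_pow_self]
      rw [pow_mul, neg_one_sq, one_pow, one_mul]
    · intro S hS hne
      obtain ⟨hSK, hadm⟩ := Finset.mem_filter.1 hS
      rw [Finset.mem_powerset] at hSK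
      simp only [Set.mem_setOf_eq] at hadm
      have hO : (((zdGraph d).neighborFinset 0).image fun u : Site d => s((0 : Site d), u)) ⊆ K \ S := originEdges_subset_sdiff ((ncard_eq_one_iff S).1 hadm) 1
      have hge : 2 * d ≤ (K \ S).card := (card_originEdges d).symm.le.trans (Finset.card_le_card hO)
      rcases hge.eq_or_lt with heq | hlt
      · exfalso
        have hOeq : (((zdGraph d).neighborFinset 0).image fun u : Site d => s((0 : Site d), u)) = K \ S :=
          Finset.eq_of_subset_of_card_le hO (by rw [← heq, card_originEdges])
        exact hne (by rw [hOeq, Finset.sdiff_sdiff_eq_self hSK])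
      · exact iteratedDeriv_mul_one_sub_pow_eq_zero (contDiff_id.pow _) hlt
  · refine Finset.sum_eq_zero fun S hS => ?_
    obtain ⟨hSK, hadm⟩ := Finset.mem_filter.1 hS
    rw [Finset.mem_powerset] at hSK
    simp only [Set.mem_setOf_eq] at hadm
    rcases Nat.lt_or_ge n 2 with hn | hn
    · interval_cases n
      · exact absurd hadm (not_ncard_eq_zero _)
      · exact absurd rfl h1
    · exact iteratedDeriv_mul_one_sub_pow_eq_zero (contDiff_id.pow _)
        (lt_of_lt_of_le (Nat.lt_succ_self _) (card_sdiff_ge hd hn hadm.1 hadm.2))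

/-! ### §3. The one-sided Taylor coefficients of `θ` at `p = 1` -/

/-- Iterated derivatives within the window of the series: `(Σ_n H_n^{(k)})^{(m)} = Σ_n H_n^{(k+m)}` on `[a, 1]`. -/
theorem iteratedDerivWithin_tsum_window (hd : 2 ≤ d) {a : ℝ}
    (ha : (1 - ((1 / (2 * (2 * (3 ^ d + 1 : ℝ) ^ 2))) ^ (5 ^ d) / ((edgesIn (zdGraph d) (box d 2)).card : ℝ))) < a)
    (ha1 : a < 1) (m : ℕ) : ∀ k : ℕ, ∀ y ∈ Set.Icc a 1,
    iteratedDerivWithin m (fun z : ℝ => ∑' n : ℕ, (1 : ℝ) * iteratedDeriv k (Russo.cylPoly (zdGraph d).edgeSet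
      (edgesTouching (zdGraph d) (box d n)) {ω : BondConfig (Site d) | ω ∩ (zdGraph d).edgeSet ∈
        {ω' : BondConfig (Site d) | (openCluster ω' 0).Finite ∧ (openCluster ω' 0).ncard = n}}) z) (Set.Icc a 1) y =
    ∑' n : ℕ, (1 : ℝ) * iteratedDeriv (k + m) (Russo.cylPoly (zdGraph d).edgeSet
      (edgesTouching (zdGraph d) (box d n)) {ω : BondConfig (Site d) | ω ∩ (zdGraph d).edgeSet ∈
        {ω' : BondConfig (Site d) | (openCluster ω' 0).Finite ∧ (openCluster ω' 0).ncard = n}}) y := by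
  have hw : ∀ n : ℕ, |(fun _ : ℕ => (1 : ℝ)) n| ≤ ((n : ℝ) + 1) ^ 0 := fun n => by simp
  induction m with
  | zero => intro k y _; rw [iteratedDerivWithin_zero, add_zero]
  | succ m ih =>
    intro k y hy
    rw [iteratedDerivWithin_succ']
    have heq : Set.EqOn (derivWithin (fun z : ℝ => ∑' n : ℕ, (1 : ℝ) * iteratedDeriv k (Russo.cylPoly (zdGraph d).edgeSet
        (edgesTouching (zdGraph d) (box d n)) {ω : BondConfig (Site d) | ω ∩ (zdGraph d).edgeSet ∈
          {ω' : BondConfig (Site d) | (openCluster ω' 0).Finite ∧ (openCluster ω' 0).ncard = n}}) z) (Set.Icc a 1))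
        (fun z : ℝ => ∑' n : ℕ, (1 : ℝ) * iteratedDeriv (k + 1) (Russo.cylPoly (zdGraph d).edgeSet
        (edgesTouching (zdGraph d) (box d n)) {ω : BondConfig (Site d) | ω ∩ (zdGraph d).edgeSet ∈
          {ω' : BondConfig (Site d) | (openCluster ω' 0).Finite ∧ (openCluster ω' 0).ncard = n}}) z) (Set.Icc a 1) :=
      fun z hz => (ChiF.hasDerivWithinAt_tsum_window hd hw ha ha1 k hz).derivWithin (uniqueDiffOn_Icc ha1 z hz)
    rw [iteratedDerivWithin_congr heq hy, ih (k + 1) y hy, show k + (m + 1) = k + 1 + m by omega]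

/-- `θ^{(m)}` within the window at `1` is `−Σ_n H_n^{(m)}(1)`, `m ≥ 1`. -/
theorem iteratedDerivWithin_theta_one_eq (hd : 2 ≤ d) {a : ℝ}
    (ha : (1 - ((1 / (2 * (2 * (3 ^ d + 1 : ℝ) ^ 2))) ^ (5 ^ d) / ((edgesIn (zdGraph d) (box d 2)).card : ℝ))) < a)
    (ha1 : a < 1) {m : ℕ} (hm : 1 ≤ m) :
    iteratedDerivWithin m (fun r : ℝ => theta (zdGraph d) 0 (GhostField.prm r)) (Set.Icc a 1) 1 =
      -∑' n : ℕ, (1 : ℝ) * iteratedDeriv m (Russo.cylPoly (zdGraph d).edgeSet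
        (edgesTouching (zdGraph d) (box d n)) {ω : BondConfig (Site d) | ω ∩ (zdGraph d).edgeSet ∈
          {ω' : BondConfig (Site d) | (openCluster ω' 0).Finite ∧ (openCluster ω' 0).ncard = n}}) 1 := by
  have ha0 : 0 ≤ a := (ChiF.windowConst_mem_Ico (d := d) (by omega)).1.trans ha.le
  have h1 : (1 : ℝ) ∈ Set.Icc a 1 := Set.right_mem_Icc.2 ha1.le
  have heq : Set.EqOn (fun r : ℝ => theta (zdGraph d) 0 (GhostField.prm r))
      (fun y : ℝ => (1 : ℝ) - ∑' n : ℕ, (1 : ℝ) * iteratedDeriv 0 (Russo.cylPoly (zdGraph d).edgeSet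
        (edgesTouching (zdGraph d) (box d n)) {ω : BondConfig (Site d) | ω ∩ (zdGraph d).edgeSet ∈
          {ω' : BondConfig (Site d) | (openCluster ω' 0).Finite ∧ (openCluster ω' 0).ncard = n}}) y) (Set.Icc a 1) :=
    fun y hy => ChiF.theta_prm_eq_one_sub_tsum_cylPoly ⟨ha0.trans hy.1, hy.2⟩
  rw [iteratedDerivWithin_congr heq h1, iteratedDerivWithin_const_sub hm, iteratedDerivWithin_fun_neg,
    iteratedDerivWithin_tsum_window hd ha ha1 m 0 1 h1, zero_add]

/-- **`θ^{(m)}(1⁻) = 0` for `1 ≤ m < 2d`** (within the window `[a,1]`, `a ∈ (a₀,1)`), every `d ≥ 2`. -/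
theorem iteratedDerivWithin_theta_one_eq_zero (hd : 2 ≤ d) {a : ℝ}
    (ha : (1 - ((1 / (2 * (2 * (3 ^ d + 1 : ℝ) ^ 2))) ^ (5 ^ d) / ((edgesIn (zdGraph d) (box d 2)).card : ℝ))) < a)
    (ha1 : a < 1) {m : ℕ} (hm : 1 ≤ m) (hm2 : m < 2 * d) :
    iteratedDerivWithin m (fun r : ℝ => theta (zdGraph d) 0 (GhostField.prm r)) (Set.Icc a 1) 1 = 0 := by
  rw [iteratedDerivWithin_theta_one_eq hd ha ha1 hm]
  have h : ∀ n : ℕ, iteratedDeriv m (Russo.cylPoly (zdGraph d).edgeSet (edgesTouching (zdGraph d) (box d n))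
      {ω : BondConfig (Site d) | ω ∩ (zdGraph d).edgeSet ∈
        {ω' : BondConfig (Site d) | (openCluster ω' 0).Finite ∧ (openCluster ω' 0).ncard = n}}) 1 = 0 :=
    fun n => iteratedDeriv_cylPoly_one_eq_zero hd n hm2
  simp only [h, mul_zero, tsum_zero, neg_zero]

/-- **`θ^{(2d)}(1⁻) = −(2d)!`** (within the window `[a,1]`), every `d ≥ 2`: the leading Taylor coefficient of `θ` at
`p = 1` is that of `1 − (1−p)^{2d}` (an isolated origin). -/
theorem iteratedDerivWithin_theta_one_two_mul (hd : 2 ≤ d) {a : ℝ}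
    (ha : (1 - ((1 / (2 * (2 * (3 ^ d + 1 : ℝ) ^ 2))) ^ (5 ^ d) / ((edgesIn (zdGraph d) (box d 2)).card : ℝ))) < a)
    (ha1 : a < 1) :
    iteratedDerivWithin (2 * d) (fun r : ℝ => theta (zdGraph d) 0 (GhostField.prm r)) (Set.Icc a 1) 1 =
      -((2 * d).factorial : ℝ) := by
  rw [iteratedDerivWithin_theta_one_eq hd ha ha1 (by omega)]
  simp only [iteratedDeriv_cylPoly_one_two_mul hd, one_mul]
  rw [tsum_ite_eq]

/-- The window `[a, 1]` and the half-line `(-∞, 1]` agree near `1`. -/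
theorem Icc_eventuallyEq_Iic {a : ℝ} (ha1 : a < 1) : (Set.Icc a 1 : Set ℝ) =ᶠ[𝓝 (1 : ℝ)] Set.Iic 1 := by
  filter_upwards [Ioi_mem_nhds ha1] with y hy
  simp only [eq_iff_iff]
  exact ⟨fun h => h.2, fun h => ⟨le_of_lt hy, h⟩⟩

/-- A point of the window. -/
theorem exists_window (hd : 1 ≤ d) : ∃ a : ℝ,
    (1 - ((1 / (2 * (2 * (3 ^ d + 1 : ℝ) ^ 2))) ^ (5 ^ d) / ((edgesIn (zdGraph d) (box d 2)).card : ℝ))) < a ∧ a < 1 := by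
  have h0 := ChiF.windowConst_mem_Ico (d := d) hd
  exact ⟨((1 - ((1 / (2 * (2 * (3 ^ d + 1 : ℝ) ^ 2))) ^ (5 ^ d) / ((edgesIn (zdGraph d) (box d 2)).card : ℝ))) + 1) / 2,
    by linarith [h0.2], by linarith [h0.2]⟩

/-- **Window-free form: `θ^{(m)}(1⁻) = 0`, `1 ≤ m < 2d`** — the `m`-th derivative of `θ∘prm` within `(-∞, 1]` at `1`. -/
theorem iteratedDerivWithin_Iic_theta_one_eq_zero (hd : 2 ≤ d) {m : ℕ} (hm : 1 ≤ m) (hm2 : m < 2 * d) :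
    iteratedDerivWithin m (fun r : ℝ => theta (zdGraph d) 0 (GhostField.prm r)) (Set.Iic 1) 1 = 0 := by
  obtain ⟨a, ha, ha1⟩ := exists_window (d := d) (by omega)
  rw [iteratedDerivWithin_eq_iteratedFDerivWithin, ← iteratedFDerivWithin_congr_set (Icc_eventuallyEq_Iic ha1),
    ← iteratedDerivWithin_eq_iteratedFDerivWithin]
  exact iteratedDerivWithin_theta_one_eq_zero hd ha ha1 hm hm2

/-- **Window-free form: `θ^{(2d)}(1⁻) = −(2d)!`** — within `(-∞, 1]` at `1`. -/
theorem iteratedDerivWithin_Iic_theta_one_two_mul (hd : 2 ≤ d) :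
    iteratedDerivWithin (2 * d) (fun r : ℝ => theta (zdGraph d) 0 (GhostField.prm r)) (Set.Iic 1) 1 =
      -((2 * d).factorial : ℝ) := by
  obtain ⟨a, ha, ha1⟩ := exists_window (d := d) (by omega)
  rw [iteratedDerivWithin_eq_iteratedFDerivWithin, ← iteratedFDerivWithin_congr_set (Icc_eventuallyEq_Iic ha1),
    ← iteratedDerivWithin_eq_iteratedFDerivWithin]
  exact iteratedDerivWithin_theta_one_two_mul hd ha ha1

/-- **`θ'(1⁻) = 0`**: `θ∘prm` has left derivative `0` at `p = 1`, every `d ≥ 2`. -/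
theorem hasDerivWithinAt_theta_one (hd : 2 ≤ d) :
    HasDerivWithinAt (fun r : ℝ => theta (zdGraph d) 0 (GhostField.prm r)) 0 (Set.Iic 1) 1 := by
  obtain ⟨a, ha, ha1⟩ := exists_window (d := d) (by omega)
  have ha0 : 0 ≤ a := (ChiF.windowConst_mem_Ico (d := d) (by omega)).1.trans ha.le
  have hw : ∀ n : ℕ, |(fun _ : ℕ => (1 : ℝ)) n| ≤ ((n : ℝ) + 1) ^ 0 := fun n => by simp
  have h1 : (1 : ℝ) ∈ Set.Icc a 1 := Set.right_mem_Icc.2 ha1.le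
  have hS := ChiF.hasDerivWithinAt_tsum_window hd hw ha ha1 0 h1
  have hzero : (∑' n : ℕ, (fun _ : ℕ => (1 : ℝ)) n * iteratedDeriv (0 + 1) (Russo.cylPoly (zdGraph d).edgeSet
      (edgesTouching (zdGraph d) (box d n)) {ω : BondConfig (Site d) | ω ∩ (zdGraph d).edgeSet ∈
        {ω' : BondConfig (Site d) | (openCluster ω' 0).Finite ∧ (openCluster ω' 0).ncard = n}}) 1) = 0 := by
    have h : ∀ n : ℕ, iteratedDeriv (0 + 1) (Russo.cylPoly (zdGraph d).edgeSet (edgesTouching (zdGraph d) (box d n))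
        {ω : BondConfig (Site d) | ω ∩ (zdGraph d).edgeSet ∈
          {ω' : BondConfig (Site d) | (openCluster ω' 0).Finite ∧ (openCluster ω' 0).ncard = n}}) 1 = 0 :=
      fun n => iteratedDeriv_cylPoly_one_eq_zero hd n (show 0 + 1 < 2 * d by omega)
    simp only [h, mul_zero, tsum_zero]
  rw [hzero] at hS
  have hθ : HasDerivWithinAt (fun r : ℝ => theta (zdGraph d) 0 (GhostField.prm r)) (-0) (Set.Icc a 1) 1 := by
    refine (hS.const_sub 1).congr_of_mem (fun y hy => ?_) h1
    exact ChiF.theta_prm_eq_one_sub_tsum_cylPoly ⟨ha0.trans hy.1, hy.2⟩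
  rw [neg_zero] at hθ
  exact hθ.mono_of_mem_nhdsWithin (Icc_mem_nhdsLE ha1)

end ThetaGerm

end Summit.CriticalPhenomena.PercolationContinuityZ3.Theorems

end
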